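import Mathlib
import HarnessLib
import Summits.Ventures.LatticeQCDFlow.Exactness.SphereLuscherSeriesSymmetry

/-!
# Weight sharing for the Engel–Schaefer action on a translation-invariant lattice: one local polynomial per order, translated to every site

HONEST FRAMING: exact (Metropolis-corrected) sampling algorithms for lattice gauge theory;
figures of merit are autocorrelation/cost numbers at stated couplings and volumes; no
continuum-physics claim.

Venture `LatticeQCDFlow` (cell pub-lqcd), topic `Exactness`; FANOUT row 7 (`s0-cpn-null`).  NEW
WORK of the cell over Mathlib and the tree's `Exactness/SphereLuscherSeriesSymmetry.lean`
(`relabel`, `exists_shared_local_luscher_series`, `luscher_series_symmetric`) and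
`Exactness/SphereLuscherSeriesLocalityES.lean` (`esLocalAction`, `couplingNbhd`, `esPart`); nothing
is cited as a fact.  Printed counterpart, NAMED ONLY: Engel–Schaefer, Comput. Phys. Commun. 182
(2011) 2107, §2–§3 (periodic `L × L` lattice, the same update at every site); M. Lüscher, Commun.
Math. Phys. 293 (2010) 899, §4.4 (translates of one local field).

## Setting

`Λ` a finite additive commutative group (e.g. the periodic lattice `ZMod L × ZMod L`), translations
`τ_n = (· + (n − n₀))`, couplings `U` that are TRANSLATION COVARIANT, `U (a + t) (b + t) = U a b`
(for CP(N−1) with frozen `U(1)` links this is the case of a translation-invariant gauge background —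
e.g. the free case; in general the links break translation covariance and only
`luscher_series_symmetric` for the actual symmetries of the background applies).

## Content

* `couplingNbhd_translate`, `esPart_translate`, `esAction_translate` — covariance of the coupling
  neighbourhoods, of the parts and invariance of the action under the translations.
* **`exists_shared_local_luscher_series_esAction`** — WEIGHT SHARING FOR THE E–S ACTION: on a
  translation-covariant background, Lüscher's recursion is solved at every order by the translates
  `Σ_n X⁽ᵏ⁾(x ∘ τ_n)` of ONE lattice polynomial `X⁽ᵏ⁾` of degree `≤ 2(k+1)` supported in the
  radius-`(k+1)` coupling ball of the base point; each translate is supported in the corresponding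
  ball of its own site.
* **`luscher_series_esAction_translation_invariant`** — and EVERY `C²` Lüscher series of such an
  action is translation invariant order by order up to additive constants.

NOT CLAIMED: anything for backgrounds that are not translation covariant beyond
`luscher_series_symmetric`; anything at `t > 0`; anything quantitative.
-/

noncomputable section

namespace Summit.Ventures.LatticeQCDFlow.Exactness

open Function Set NormedSpace InnerProductSpace Metric
open scoped RealInnerProductSpace ContDiff

variable {Λ : Type*} [AddCommGroup Λ] {E : Type*} [NormedAddCommGroup E] [InnerProductSpace ℝ E]

/-! ## §1 Translation covariance of the Engel–Schaefer data -/

section Covariance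

variable [Fintype Λ] [DecidableEq Λ] {U : Λ → Λ → (E →L[ℝ] E)}

omit [Fintype Λ] [DecidableEq Λ] in
/-- **Covariance of the coupling neighbourhoods**: `couplingNbhd U (a + t) = (· + t) '' couplingNbhd U a`
for translation-covariant couplings. -/
theorem couplingNbhd_translate (hU : ∀ t a b : Λ, U (a + t) (b + t) = U a b) (t a : Λ) :
    couplingNbhd U (Equiv.addRight t a) = Equiv.addRight t '' couplingNbhd U a := by
  ext m
  simp only [couplingNbhd, Equiv.coe_addRight, mem_setOf_eq, mem_image]
  constructor
  · intro h
    refine ⟨m - t, ?_, by simp⟩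
    have e : U (a + t) m = U a (m - t) := by
      have := hU t a (m - t); rwa [sub_add_cancel] at this
    rwa [e] at h
  · rintro ⟨m', hm', rfl⟩
    rwa [hU]

omit [DecidableEq Λ] in
/-- **Covariance of the parts**: `s_{a+t}(x) = s_a(x ∘ (· + t))`. -/
theorem esPart_translate (hU : ∀ t a b : Λ, U (a + t) (b + t) = U a b) (κ S₀ : ℝ) (t a : Λ) :
    esPart κ S₀ U (Equiv.addRight t a) = relabel (Equiv.addRight t) (esPart κ S₀ U a) := by
  funext x
  simp only [esPart, relabel, localField, comp_apply, Equiv.coe_addRight]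
  congr 2
  rw [← Equiv.sum_comp (Equiv.addRight t) (fun m => U (a + t) m (x m))]
  simp only [Equiv.coe_addRight, hU]

omit [DecidableEq Λ] in
/-- **Invariance of the action**: `S(x ∘ (· + t)) = S(x)` for translation-covariant couplings. -/
theorem esAction_translate (hU : ∀ t a b : Λ, U (a + t) (b + t) = U a b) (κ S₀ : ℝ) (t : Λ) :
    relabel (Equiv.addRight t) (esAction κ S₀ U) = esAction κ S₀ U := by
  funext x
  simp only [esAction, relabel, localField, comp_apply]
  congr 2
  symm
  rw [← Equiv.sum_comp (Equiv.addRight t) (fun n => ⟪x n, ∑ m, U n m (x m)⟫)]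
  refine Finset.sum_congr rfl fun n _ => ?_
  simp only [Equiv.coe_addRight]
  congr 1
  rw [← Equiv.sum_comp (Equiv.addRight t) (fun m => U (n + t) m (x m))]
  simp only [Equiv.coe_addRight, hU]

end Covariance

/-! ## §2 Weight sharing and translation invariance -/

section Sharing

variable [FiniteDimensional ℝ E] [MeasurableSpace E] [BorelSpace E] [Fintype Λ] [DecidableEq Λ]
  {U : Λ → Λ → (E →L[ℝ] E)}

/-- **WEIGHT SHARING FOR THE ENGEL–SCHAEFER ACTION ON A TRANSLATION-COVARIANT BACKGROUND.**  On a
finite abelian group lattice with `U (a + t) (b + t) = U a b` (no self-coupling, adjoint pairs;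
`dim E ≥ 2`), for each order `k` there is ONE lattice polynomial `X⁽ᵏ⁾` of degree `≤ 2(k+1)` supported
in the radius-`(k+1)` coupling ball of the base point `n₀`, such that its translates
`Y_n⁽ᵏ⁾(x) = X⁽ᵏ⁾(x ∘ (· + (n − n₀)))` (each supported in the radius-`(k+1)` ball of `n`) sum to a
solution `S̃⁽ᵏ⁾ = Σ_n Y_n⁽ᵏ⁾` of Lüscher's recursion for `S = esAction κ S₀ U` on the product of unit
spheres. -/
theorem exists_shared_local_luscher_series_esAction (h2 : 2 ≤ Module.finrank ℝ E)
    (hU0 : ∀ n, U n n = 0) (hUadj : ∀ m n (v w : E), ⟪U m n v, w⟫ = ⟪v, U n m w⟫)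
    (hU : ∀ t a b : Λ, U (a + t) (b + t) = U a b) (κ S₀ : ℝ) (n₀ : Λ) :
    ∃ (X : ℕ → (Λ → E) → ℝ) (c : ℕ → ℝ),
      (∀ k, X k ∈ polySD Λ E (2 * (k + 1)) (nball (couplingNbhd U) (k + 1) n₀)) ∧
      (∀ k n, relabel (Equiv.addRight (n - n₀)) (X k) ∈
        polySD Λ E (2 * (k + 1)) (nball (couplingNbhd U) (k + 1) n)) ∧
      (∀ ξ : Λ → sphere (0 : E) 1,
        -∑ j, siteLaplacian j (fun x => ∑ n, relabel (Equiv.addRight (n - n₀)) (X 0) x)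
            (fun m => (ξ m : E)) = esAction κ S₀ U (fun m => (ξ m : E)) + c 0) ∧
      (∀ k, ∀ ξ : Λ → sphere (0 : E) 1,
        -∑ j, siteLaplacian j (fun x => ∑ n, relabel (Equiv.addRight (n - n₀)) (X (k + 1)) x)
            (fun m => (ξ m : E)) =
          -(∑ j, ⟪siteGrad j (esAction κ S₀ U) (fun m => (ξ m : E)),
              siteGrad j (fun x => ∑ n, relabel (Equiv.addRight (n - n₀)) (X k) x)
                (fun m => (ξ m : E))⟫) + c (k + 1)) := by
  haveI : Nonempty Λ := ⟨n₀⟩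
  have hτ : ∀ n : Λ, Equiv.addRight (n - n₀) n₀ = n := fun n => by simp
  have hN : ∀ n a : Λ, (esLocalAction hU0 hUadj κ S₀).N (Equiv.addRight (n - n₀) a) =
      Equiv.addRight (n - n₀) '' (esLocalAction hU0 hUadj κ S₀).N a :=
    fun n a => couplingNbhd_translate hU _ a
  have hpart : ∀ n : Λ, (esLocalAction hU0 hUadj κ S₀).part n =
      relabel (Equiv.addRight (n - n₀)) ((esLocalAction hU0 hUadj κ S₀).part n₀) := fun n => by
    have h := esPart_translate hU κ S₀ (n - n₀) n₀
    rw [hτ n] at h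
    exact h
  have hS : ∀ n : Λ, relabel (Equiv.addRight (n - n₀)) (esLocalAction hU0 hUadj κ S₀).action =
      (esLocalAction hU0 hUadj κ S₀).action := fun n => by
    rw [esLocalAction_action]; exact esAction_translate hU κ S₀ _
  obtain ⟨X, c, hX, hY, h0, hs⟩ := exists_shared_local_luscher_series h2
    (esLocalAction hU0 hUadj κ S₀) n₀ (fun n => Equiv.addRight (n - n₀)) hτ hN hpart hS
  rw [esLocalAction_action hU0 hUadj] at h0 hs
  exact ⟨X, c, hX, hY, h0, hs⟩

/-- **EVERY LÜSCHER SERIES OF A TRANSLATION-COVARIANT E–S ACTION IS TRANSLATION INVARIANT ORDER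
BY ORDER, UP TO CONSTANTS**: `S̃⁽ᵏ⁾(ξ ∘ (· + t)) = S̃⁽ᵏ⁾(ξ) + d_k(t)` on the product of unit spheres. -/
theorem luscher_series_esAction_translation_invariant [Nonempty Λ] (h2 : 2 ≤ Module.finrank ℝ E)
    (hU : ∀ t a b : Λ, U (a + t) (b + t) = U a b) (κ S₀ : ℝ) {St : ℕ → (Λ → E) → ℝ} {c : ℕ → ℝ}
    (hSt : ∀ k, ContDiff ℝ 2 (St k))
    (h0 : ∀ ξ : Λ → sphere (0 : E) 1,
      -∑ n, siteLaplacian n (St 0) (fun m => (ξ m : E)) =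
        esAction κ S₀ U (fun m => (ξ m : E)) + c 0)
    (hs : ∀ k, ∀ ξ : Λ → sphere (0 : E) 1,
      -∑ n, siteLaplacian n (St (k + 1)) (fun m => (ξ m : E)) =
        -(∑ n, ⟪siteGrad n (esAction κ S₀ U) (fun m => (ξ m : E)),
            siteGrad n (St k) (fun m => (ξ m : E))⟫) + c (k + 1)) (t : Λ) (k : ℕ) :
    ∃ d : ℝ, ∀ ξ : Λ → sphere (0 : E) 1,
      St k ((fun m => (ξ m : E)) ∘ Equiv.addRight t) = St k (fun m => (ξ m : E)) + d :=
  luscher_series_symmetric (Equiv.addRight t) h2 (esAction_translate hU κ S₀ t) hSt h0 hs k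

end Sharing

end Summit.Ventures.LatticeQCDFlow.Exactness

end
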